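import Summits.BirchSwinnertonDyer.BirchSwinnertonDyer.Theorems.AlignedTransportAtTwoMainConjectureOfRankZeroBSDAtTwoCubicRelationDoor
import Literature.NumberTheory.IwasawaTheory.ClassicalMuVanishesLayerThreeGeneralRelationCertificateTwo
import HarnessLib

/-!
# Route `AlignedTransportAtTwo`, crux C2 `MainConjectureOfRankZeroBSDAtTwo` (stmt-BirchSwinnertonDyer-22298):
# THE GENERAL LAYER-THREE RELATION DOOR IN COORDINATES — `μ₂ = 0`, `λ₂ ≤ d`, `rank₂ Cl(K_m) ≤ d ∀ m` for the cubic `2`-torsion field `ℚ(β)` on the sub-cell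
# `Δ_min ≡ 5 (mod 8)`, `Δ_W < 0`, `h(ℚ(β))` odd, `t ≥ 3`, from ANY relation row `∏ σ^i(c)^{eᵢ} = 1` (`Σ eᵢXⁱ = (X−1)^d u + 2g`, `d ≤ 6`) at layer `K_3 = ℚ(β)·ℚ(ζ₃₂)⁺`
# written in `𝓞_{ℚ(β)}`: eight power-memberships, seven coprimality Bézouts, one norm

HONEST FRAMING (cell `bsd-f1-sign2`, WIDTH-5 attached prover seat `bsd-line-att-p4` gen 43 on line `birth` of the lead `bsd-line-att-p2`;
`--supports` stmt-BirchSwinnertonDyer-22298, closes nothing; BSD is NOT proved by any of this; the crux C2, its verdict «blocked-on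
`Rank1Residual.GreenbergMuConjectureIrreducible`» and every registered stub are untouched).  THEOREMS ONLY — no definition, no named fact, no `sorry`.

WHAT.  The `W`-level form of this seat's Literature theorem `IwasawaTheory.classicalMuVanishes_two_of_generalRelationCert_layer_three` (general-exponent sister of
`…CubicLayerThreeRelationDoor`, which is the shape `f = 1 + X + X⁴ + X⁵` only): `W` good ordinary at `2`, no rational `2`-torsion abscissa, `Δ_min ≡ 5 (8)`, `Δ_W < 0`,
`β` a root of the `2`-division cubic, `K = ℚ(β)` with `h_K` odd, `2 ∤ d_K`, `𝔭₁` of norm `2`, a unit `ε ≡ ±1 (mod 𝔭₁³)` with `±ε` non-squares (so `t ≥ 3`); and the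
RELATION ROW DATA in `𝓞_K`: `q₀` (`(q₀)` maximal, `q₀ ≡ ±3 (mod 𝔭₁³)`), `t ∈ ℤ`, `ψ : 𝓞_K → ℤ/q` (`ψ q₀ = 0`, `P(t) = 0`, `2` invertible), `α q₀⁸ + β' P(t) = q₀`, the seven
coprimality witnesses `α_k q₀ + v_k p_k(t) = 1` (`p_k` the integer polynomials `t³−4t, −t⁷+7t⁵−14t³+6t, t⁵−5t³+4t, −2t, −t³+2t, t⁷−7t⁵+14t³−8t, −t⁵+5t³−6t`), exponents
`e₀,…,e₇` (`Σ = n`, `Σ eᵢXⁱ = (X−1)^d u + 2g`, `u(1)` odd, `d + 2 ≤ 8`), ONE element `y` of `K_3` (eight `𝓞_K`-coordinates on `1, s₁, s₂, s₁s₂, s₃, s₁s₃, s₂s₃, s₁s₂s₃`) with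
the eight membership certificates `y = Σ_k c_k q₀^{eᵢ−k} (σ^i s₃ − t)^k` (ring identities, universally quantified) and `N_{K_3/K}(y) = ε_y q₀ⁿ` (tower-norm templates `U, V`).
THEN for EVERY cyclotomic `ℤ₂`-extension `κ` of `ℚ(β)`: **`rank₂ Cl(K_m) ≤ d ∀ m`, `μ₂(κ) = 0`, `λ₂(κ) ≤ d`.**

CELL READING: consumes whatever relation `Cl(K_3)` has — the squares relation of 3523 (`D = 3`), the `(1+X)(1+X⁴)` relation of 1259 / 14891 (`D = 5`), and the unknown
relations of the converse-quadrant seeds 1187 / 14539 (no relation of nilpotency `≤ 2` exists at layer two) — from ONE principal generator.  Nothing about any curve is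
asserted HERE; BSD is not proved; nothing is closed.

References: [Washington1997] §13.1, §13.3 Prop. 13.22–13.23; [Lang1990] Ch. 13 §4 Lemma 4.1; [Gras2003] IV.4; [Fukuda1994] Thm. 1; [NeukirchANT1999] Ch. I §3, §8,
Ch. III (1.6)–(1.7); [Serre1973CourseArithmetic] Ch. III §1.2; [Cohen1993] §4.7, §6.5; tree: att-p3 g48/g49 `…CubicRelationDoor`, this seat's Literature files
`NumberFields/SqrtTwoTowerThreeGaloisAction`, `IwasawaTheory/ClassicalMuVanishesLayerThreeGeneralRelationCertificateTwo`.
-/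

set_option linter.dupNamespace false
set_option autoImplicit false

noncomputable section

open scoped Classical NumberField nonZeroDivisors

namespace Summit.BirchSwinnertonDyer.BirchSwinnertonDyer.Theorems.AlignedTransportAtTwoCubicLayerThreeGeneralRelationDoor

open NumberField IsDedekindDomain Polynomial WeierstrassCurve IntermediateField CongruenceSubgroup Finset
  Literature.NumberTheory.IwasawaTheory Literature.NumberTheory.GaloisRepresentations
  Literature.NumberTheory.GaloisRepresentations.Herbrand Literature.NumberTheory.GaloisRepresentations.MinkowskiUnit
  Literature.NumberTheory.GaloisRepresentations.CyclicNormIndex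
  Literature.NumberTheory.EllipticCurves Literature.NumberTheory.EllipticCurves.Greenberg1999
  Literature.NumberTheory.EllipticCurves.ModularForms
  Literature.NumberTheory.EllipticCurves.Rank1Residual
  Literature.NumberTheory.EllipticCurves.Module
  Literature.NumberTheory.NumberFields Literature.NumberTheory.NumberFields.AmbiguousClass
  Summit.BirchSwinnertonDyer.Rank1Residual
  Summit.BirchSwinnertonDyer.Rank1Residual.X1.MuLambda
  Summit.BirchSwinnertonDyer.Rank1Residual.X5
  Summit.BirchSwinnertonDyer.Rank1Residual.F1Sign2
  Summit.BirchSwinnertonDyer.BirchSwinnertonDyer.Theorems.Rank1ResidualX1Defs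
  Summit.BirchSwinnertonDyer.BirchSwinnertonDyer.Theses.AlignedTransportAtTwo
  Summit.BirchSwinnertonDyer.BirchSwinnertonDyer.Theorems.AlignedTransportAtTwoKilfordStratumShared
  Summit.BirchSwinnertonDyer.BirchSwinnertonDyer.Theorems.AlignedTransportAtTwoCubicCarrierRoad
  Summit.BirchSwinnertonDyer.BirchSwinnertonDyer.Theorems.AlignedTransportAtTwoCubicKilfordPrimes
  Summit.BirchSwinnertonDyer.BirchSwinnertonDyer.Theorems.AlignedTransportAtTwoCubicDepthDoorGenusCert
  Summit.BirchSwinnertonDyer.BirchSwinnertonDyer.Theorems.AlignedTransportAtTwoCubicPrimesOfEmbeddings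
  Summit.BirchSwinnertonDyer.BirchSwinnertonDyer.Theorems.AlignedTransportAtTwoCubicLayerOneDoors

variable (W : WeierstrassCurve ℚ) [W.IsElliptic] [W.IsGloballyMinimal]

set_option synthInstance.maxHeartbeats 400000 in
set_option maxHeartbeats 1600000 in
/-- **THE GENERAL LAYER-THREE RELATION DOOR IN COORDINATES** for the cubic `2`-torsion field `K = ℚ(β)` (`Δ_min ≡ 5 (8)`, `Δ_W < 0`, `h_K` odd, `2 ∤ d_K`,
`t ≥ 3`): from the displayed relation-row data in `𝓞_K` (module docstring; ANY exponent vector with `d + 2 ≤ 8`) — **`rank₂ Cl(K_m) ≤ d ∀ m`, `μ₂(κ) = 0`, `λ₂(κ) ≤ d`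
for every cyclotomic `ℤ₂`-extension `κ` of `K`.**  Two dyadic primes, `𝓞_K/𝔭₁ = 𝔽₂` and «all units `≡ ±1 (mod 𝔭₁³)`» are derived as in att-p3's `…CubicRelationDoor`;
then this seat's `IwasawaTheory.classicalMuVanishes_two_of_generalRelationCert_layer_three`. [cite: Washington1997, §13.3 Prop. 13.22–13.23]
[cite: Lang1990, Ch. 13 §4, Lemma 4.1 (PDF pp. 203–204)] [cite: NeukirchANT1999, Ch. III (1.6)–(1.7); Ch. I §3 (3.3)] [cite: Cohen1993, §4.7, §6.5] -/
theorem classicalMuVanishes_adjoin_of_generalRelationCert_layer_three (hord : IsOrdinaryAt W 2)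
    (ht : ∀ x : ℚ, ¬ HasRationalTwoTorsionX W x) (h85 : minimalDiscriminantInt W % 8 = 5) (hΔ : W.Δ < 0)
    {β : AlgebraicClosure ℚ} (hβ : aeval β W.twoTorsionPolynomial.toPoly = 0)
    (hh : haveI : FiniteDimensional ℚ ↥(IntermediateField.adjoin ℚ ({β} : Set (AlgebraicClosure ℚ))) :=
        IntermediateField.adjoin.finiteDimensional ((AlgebraicClosure.isAlgebraic ℚ).isAlgebraic β).isIntegral
      haveI : NumberField ↥(IntermediateField.adjoin ℚ ({β} : Set (AlgebraicClosure ℚ))) := NumberField.mk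
      ¬ 2 ∣ classNumber ↥(IntermediateField.adjoin ℚ ({β} : Set (AlgebraicClosure ℚ))))
    (hd : haveI : FiniteDimensional ℚ ↥(IntermediateField.adjoin ℚ ({β} : Set (AlgebraicClosure ℚ))) :=
        IntermediateField.adjoin.finiteDimensional ((AlgebraicClosure.isAlgebraic ℚ).isAlgebraic β).isIntegral
      haveI : NumberField ↥(IntermediateField.adjoin ℚ ({β} : Set (AlgebraicClosure ℚ))) := NumberField.mk
      ¬ (2 : ℤ) ∣ NumberField.discr ↥(IntermediateField.adjoin ℚ ({β} : Set (AlgebraicClosure ℚ))))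
    (𝔭₁ : Ideal (𝓞 ↥(IntermediateField.adjoin ℚ ({β} : Set (AlgebraicClosure ℚ)))))
    (hN : haveI : FiniteDimensional ℚ ↥(IntermediateField.adjoin ℚ ({β} : Set (AlgebraicClosure ℚ))) :=
        IntermediateField.adjoin.finiteDimensional ((AlgebraicClosure.isAlgebraic ℚ).isAlgebraic β).isIntegral
      haveI : NumberField ↥(IntermediateField.adjoin ℚ ({β} : Set (AlgebraicClosure ℚ))) := NumberField.mk
      Ideal.absNorm 𝔭₁ = 2)
    {ε : (𝓞 ↥(IntermediateField.adjoin ℚ ({β} : Set (AlgebraicClosure ℚ))))ˣ} (hε : (ε : 𝓞 ↥(IntermediateField.adjoin ℚ ({β} : Set (AlgebraicClosure ℚ)))) - 1 ∈ 𝔭₁ ^ 3 ∨ (ε : 𝓞 ↥(IntermediateField.adjoin ℚ ({β} : Set (AlgebraicClosure ℚ)))) + 1 ∈ 𝔭₁ ^ 3) (hnsq : ∀ z : (𝓞 ↥(IntermediateField.adjoin ℚ ({β} : Set (AlgebraicClosure ℚ))))ˣ, ε ≠ z ^ 2 ∧ ε ≠ -z ^ 2)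
    (κP : ZpExtension ↥(IntermediateField.adjoin ℚ ({β} : Set (AlgebraicClosure ℚ))) 2) (hκP : κP.IsCyclotomic)
    (q₀ : 𝓞 ↥(IntermediateField.adjoin ℚ ({β} : Set (AlgebraicClosure ℚ)))) (hq₀ : (Ideal.span {q₀}).IsMaximal) (hπ : q₀ - 3 ∈ 𝔭₁ ^ 3 ∨ q₀ + 3 ∈ 𝔭₁ ^ 3)
    (t : ℤ) {q : ℕ} (hq : 1 < q) (ψ : 𝓞 ↥(IntermediateField.adjoin ℚ ({β} : Set (AlgebraicClosure ℚ))) →+* ZMod q) (hψ : ψ q₀ = 0) {ti : ZMod q} (hti : 2 * ti = 1)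
    (hPt : (((t : ZMod q) ^ 2 - 2) ^ 2 - 2) ^ 2 - 2 = 0)
    (α β' : 𝓞 ↥(IntermediateField.adjoin ℚ ({β} : Set (AlgebraicClosure ℚ)))) (hBez : α * q₀ ^ 8 + β' * ((((t : 𝓞 ↥(IntermediateField.adjoin ℚ ({β} : Set (AlgebraicClosure ℚ)))) ^ 2 - 2) ^ 2 - 2) ^ 2 - 2) = q₀)
    (α₁ v₁ : 𝓞 ↥(IntermediateField.adjoin ℚ ({β} : Set (AlgebraicClosure ℚ)))) (hC₁ : α₁ * q₀ + v₁ * ((-4) * (t : 𝓞 ↥(IntermediateField.adjoin ℚ ({β} : Set (AlgebraicClosure ℚ)))) + (t : 𝓞 ↥(IntermediateField.adjoin ℚ ({β} : Set (AlgebraicClosure ℚ)))) ^ 3) = 1)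
    (α₂ v₂ : 𝓞 ↥(IntermediateField.adjoin ℚ ({β} : Set (AlgebraicClosure ℚ)))) (hC₂ : α₂ * q₀ + v₂ * (6 * (t : 𝓞 ↥(IntermediateField.adjoin ℚ ({β} : Set (AlgebraicClosure ℚ)))) + (-14) * (t : 𝓞 ↥(IntermediateField.adjoin ℚ ({β} : Set (AlgebraicClosure ℚ)))) ^ 3 + 7 * (t : 𝓞 ↥(IntermediateField.adjoin ℚ ({β} : Set (AlgebraicClosure ℚ)))) ^ 5 + (-1) * (t : 𝓞 ↥(IntermediateField.adjoin ℚ ({β} : Set (AlgebraicClosure ℚ)))) ^ 7) = 1)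
    (α₃ v₃ : 𝓞 ↥(IntermediateField.adjoin ℚ ({β} : Set (AlgebraicClosure ℚ)))) (hC₃ : α₃ * q₀ + v₃ * (4 * (t : 𝓞 ↥(IntermediateField.adjoin ℚ ({β} : Set (AlgebraicClosure ℚ)))) + (-5) * (t : 𝓞 ↥(IntermediateField.adjoin ℚ ({β} : Set (AlgebraicClosure ℚ)))) ^ 3 + (t : 𝓞 ↥(IntermediateField.adjoin ℚ ({β} : Set (AlgebraicClosure ℚ)))) ^ 5) = 1)
    (α₄ v₄ : 𝓞 ↥(IntermediateField.adjoin ℚ ({β} : Set (AlgebraicClosure ℚ)))) (hC₄ : α₄ * q₀ + v₄ * ((-2) * (t : 𝓞 ↥(IntermediateField.adjoin ℚ ({β} : Set (AlgebraicClosure ℚ))))) = 1)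
    (α₅ v₅ : 𝓞 ↥(IntermediateField.adjoin ℚ ({β} : Set (AlgebraicClosure ℚ)))) (hC₅ : α₅ * q₀ + v₅ * (2 * (t : 𝓞 ↥(IntermediateField.adjoin ℚ ({β} : Set (AlgebraicClosure ℚ)))) + (-1) * (t : 𝓞 ↥(IntermediateField.adjoin ℚ ({β} : Set (AlgebraicClosure ℚ)))) ^ 3) = 1)
    (α₆ v₆ : 𝓞 ↥(IntermediateField.adjoin ℚ ({β} : Set (AlgebraicClosure ℚ)))) (hC₆ : α₆ * q₀ + v₆ * ((-8) * (t : 𝓞 ↥(IntermediateField.adjoin ℚ ({β} : Set (AlgebraicClosure ℚ)))) + 14 * (t : 𝓞 ↥(IntermediateField.adjoin ℚ ({β} : Set (AlgebraicClosure ℚ)))) ^ 3 + (-7) * (t : 𝓞 ↥(IntermediateField.adjoin ℚ ({β} : Set (AlgebraicClosure ℚ)))) ^ 5 + (t : 𝓞 ↥(IntermediateField.adjoin ℚ ({β} : Set (AlgebraicClosure ℚ)))) ^ 7) = 1)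
    (α₇ v₇ : 𝓞 ↥(IntermediateField.adjoin ℚ ({β} : Set (AlgebraicClosure ℚ)))) (hC₇ : α₇ * q₀ + v₇ * ((-6) * (t : 𝓞 ↥(IntermediateField.adjoin ℚ ({β} : Set (AlgebraicClosure ℚ)))) + 5 * (t : 𝓞 ↥(IntermediateField.adjoin ℚ ({β} : Set (AlgebraicClosure ℚ)))) ^ 3 + (-1) * (t : 𝓞 ↥(IntermediateField.adjoin ℚ ({β} : Set (AlgebraicClosure ℚ)))) ^ 5) = 1)
    (e₀ e₁ e₂ e₃ e₄ e₅ e₆ e₇ : ℕ) {n d : ℕ} (hn : e₀ + e₁ + e₂ + e₃ + e₄ + e₅ + e₆ + e₇ = n) (hd2 : d + 2 ≤ 8) {u g : ℤ[X]} (hu : ¬ (2 : ℤ) ∣ u.eval 1)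
    (hF : (C (e₀ : ℤ) + C (e₁ : ℤ) * X + C (e₂ : ℤ) * X ^ 2 + C (e₃ : ℤ) * X ^ 3 + C (e₄ : ℤ) * X ^ 4 + C (e₅ : ℤ) * X ^ 5 + C (e₆ : ℤ) * X ^ 6 +
      C (e₇ : ℤ) * X ^ 7 : ℤ[X]) = (X - 1) ^ d * u + C (2 : ℤ) * g)
    (y₀ y₁ y₂ y₃ y₄ y₅ y₆ y₇ : 𝓞 ↥(IntermediateField.adjoin ℚ ({β} : Set (AlgebraicClosure ℚ))))
    (hmem₀ : ∀ (R : Type) [CommRing R] (φ : 𝓞 ↥(IntermediateField.adjoin ℚ ({β} : Set (AlgebraicClosure ℚ))) →+* R) (S₁ S₂ S₃ : R), S₁ ^ 2 = 2 → S₂ ^ 2 = 2 + S₁ → S₃ ^ 2 = 2 + S₂ →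
      ∃ c : ℕ → R, φ y₀ + φ y₁ * S₁ + (φ y₂ + φ y₃ * S₁) * S₂ + (φ y₄ + φ y₅ * S₁ + (φ y₆ + φ y₇ * S₁) * S₂) * S₃ =
        ∑ k ∈ Finset.range (e₀ + 1), c k * φ q₀ ^ (e₀ - k) * (S₃ - (t : R)) ^ k)
    (hmem₁ : ∀ (R : Type) [CommRing R] (φ : 𝓞 ↥(IntermediateField.adjoin ℚ ({β} : Set (AlgebraicClosure ℚ))) →+* R) (S₁ S₂ S₃ : R), S₁ ^ 2 = 2 → S₂ ^ 2 = 2 + S₁ → S₃ ^ 2 = 2 + S₂ →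
      ∃ c : ℕ → R, φ y₀ + φ y₁ * S₁ + (φ y₂ + φ y₃ * S₁) * S₂ + (φ y₄ + φ y₅ * S₁ + (φ y₆ + φ y₇ * S₁) * S₂) * S₃ =
        ∑ k ∈ Finset.range (e₁ + 1), c k * φ q₀ ^ (e₁ - k) * (S₂ * S₃ - S₃ - (t : R)) ^ k)
    (hmem₂ : ∀ (R : Type) [CommRing R] (φ : 𝓞 ↥(IntermediateField.adjoin ℚ ({β} : Set (AlgebraicClosure ℚ))) →+* R) (S₁ S₂ S₃ : R), S₁ ^ 2 = 2 → S₂ ^ 2 = 2 + S₁ → S₃ ^ 2 = 2 + S₂ →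
      ∃ c : ℕ → R, φ y₀ + φ y₁ * S₁ + (φ y₂ + φ y₃ * S₁) * S₂ + (φ y₄ + φ y₅ * S₁ + (φ y₆ + φ y₇ * S₁) * S₂) * S₃ =
        ∑ k ∈ Finset.range (e₂ + 1), c k * φ q₀ ^ (e₂ - k) * (S₃ + S₁ * S₃ - S₁ * S₂ * S₃ - (t : R)) ^ k)
    (hmem₃ : ∀ (R : Type) [CommRing R] (φ : 𝓞 ↥(IntermediateField.adjoin ℚ ({β} : Set (AlgebraicClosure ℚ))) →+* R) (S₁ S₂ S₃ : R), S₁ ^ 2 = 2 → S₂ ^ 2 = 2 + S₁ → S₃ ^ 2 = 2 + S₂ →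
      ∃ c : ℕ → R, φ y₀ + φ y₁ * S₁ + (φ y₂ + φ y₃ * S₁) * S₂ + (φ y₄ + φ y₅ * S₁ + (φ y₆ + φ y₇ * S₁) * S₂) * S₃ =
        ∑ k ∈ Finset.range (e₃ + 1), c k * φ q₀ ^ (e₃ - k) * (S₃ + S₁ * S₃ - S₂ * S₃ - (t : R)) ^ k)
    (hmem₄ : ∀ (R : Type) [CommRing R] (φ : 𝓞 ↥(IntermediateField.adjoin ℚ ({β} : Set (AlgebraicClosure ℚ))) →+* R) (S₁ S₂ S₃ : R), S₁ ^ 2 = 2 → S₂ ^ 2 = 2 + S₁ → S₃ ^ 2 = 2 + S₂ →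
      ∃ c : ℕ → R, φ y₀ + φ y₁ * S₁ + (φ y₂ + φ y₃ * S₁) * S₂ + (φ y₄ + φ y₅ * S₁ + (φ y₆ + φ y₇ * S₁) * S₂) * S₃ =
        ∑ k ∈ Finset.range (e₄ + 1), c k * φ q₀ ^ (e₄ - k) * (-S₃ - (t : R)) ^ k)
    (hmem₅ : ∀ (R : Type) [CommRing R] (φ : 𝓞 ↥(IntermediateField.adjoin ℚ ({β} : Set (AlgebraicClosure ℚ))) →+* R) (S₁ S₂ S₃ : R), S₁ ^ 2 = 2 → S₂ ^ 2 = 2 + S₁ → S₃ ^ 2 = 2 + S₂ →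
      ∃ c : ℕ → R, φ y₀ + φ y₁ * S₁ + (φ y₂ + φ y₃ * S₁) * S₂ + (φ y₄ + φ y₅ * S₁ + (φ y₆ + φ y₇ * S₁) * S₂) * S₃ =
        ∑ k ∈ Finset.range (e₅ + 1), c k * φ q₀ ^ (e₅ - k) * (S₃ - S₂ * S₃ - (t : R)) ^ k)
    (hmem₆ : ∀ (R : Type) [CommRing R] (φ : 𝓞 ↥(IntermediateField.adjoin ℚ ({β} : Set (AlgebraicClosure ℚ))) →+* R) (S₁ S₂ S₃ : R), S₁ ^ 2 = 2 → S₂ ^ 2 = 2 + S₁ → S₃ ^ 2 = 2 + S₂ →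
      ∃ c : ℕ → R, φ y₀ + φ y₁ * S₁ + (φ y₂ + φ y₃ * S₁) * S₂ + (φ y₄ + φ y₅ * S₁ + (φ y₆ + φ y₇ * S₁) * S₂) * S₃ =
        ∑ k ∈ Finset.range (e₆ + 1), c k * φ q₀ ^ (e₆ - k) * (-S₃ - S₁ * S₃ + S₁ * S₂ * S₃ - (t : R)) ^ k)
    (hmem₇ : ∀ (R : Type) [CommRing R] (φ : 𝓞 ↥(IntermediateField.adjoin ℚ ({β} : Set (AlgebraicClosure ℚ))) →+* R) (S₁ S₂ S₃ : R), S₁ ^ 2 = 2 → S₂ ^ 2 = 2 + S₁ → S₃ ^ 2 = 2 + S₂ →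
      ∃ c : ℕ → R, φ y₀ + φ y₁ * S₁ + (φ y₂ + φ y₃ * S₁) * S₂ + (φ y₄ + φ y₅ * S₁ + (φ y₆ + φ y₇ * S₁) * S₂) * S₃ =
        ∑ k ∈ Finset.range (e₇ + 1), c k * φ q₀ ^ (e₇ - k) * (-S₃ - S₁ * S₃ + S₂ * S₃ - (t : R)) ^ k)
    (U₀ U₁ U₂ U₃ V₀ V₁ : 𝓞 ↥(IntermediateField.adjoin ℚ ({β} : Set (AlgebraicClosure ℚ))))
    (hU₀ : U₀ = -8 * y₇ ^ 2 - 8 * y₆ * y₇ - 4 * y₆ ^ 2 - 8 * y₅ * y₇ - 4 * y₅ * y₆ - 4 * y₅ ^ 2 - 4 * y₄ * y₇ - 4 * y₄ * y₆ - 2 * y₄ ^ 2 + 4 * y₃ ^ 2 + 4 * y₂ * y₃ +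
        2 * y₂ ^ 2 + 2 * y₁ ^ 2 + y₀ ^ 2)
    (hU₁ : U₁ = -4 * y₇ ^ 2 - 8 * y₆ * y₇ - 2 * y₆ ^ 2 - 4 * y₅ * y₇ - 4 * y₅ * y₆ - 4 * y₄ * y₇ - 2 * y₄ * y₆ - 4 * y₄ * y₅ + 2 * y₃ ^ 2 + 4 * y₂ * y₃ + y₂ ^ 2 +
        2 * y₀ * y₁)
    (hU₂ : U₂ = -4 * y₇ ^ 2 - 4 * y₆ * y₇ - 2 * y₆ ^ 2 - 8 * y₅ * y₇ - 2 * y₅ ^ 2 - 4 * y₄ * y₆ - y₄ ^ 2 + 4 * y₁ * y₃ + 2 * y₀ * y₂)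
    (hU₃ : U₃ = -2 * y₇ ^ 2 - 4 * y₆ * y₇ - y₆ ^ 2 - 4 * y₅ * y₆ - 4 * y₄ * y₇ - 2 * y₄ * y₅ + 2 * y₁ * y₂ + 2 * y₀ * y₃)
    (hV₀ : V₀ = -4 * U₃ ^ 2 - 4 * U₂ * U₃ - 2 * U₂ ^ 2 + 2 * U₁ ^ 2 + U₀ ^ 2) (hV₁ : V₁ = -2 * U₃ ^ 2 - 4 * U₂ * U₃ - U₂ ^ 2 + 2 * U₀ * U₁)
    (εy : (𝓞 ↥(IntermediateField.adjoin ℚ ({β} : Set (AlgebraicClosure ℚ))))ˣ) (hNy : V₀ ^ 2 - 2 * V₁ ^ 2 = εy * q₀ ^ n) :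
    (∀ m, classGroupPRank κP m ≤ d) ∧ ClassicalMuVanishes κP ∧ classicalLambda κP ≤ d := by
  have hirr := AlignedTransportAtTwoSeed.irr_two_of_forall_not_hasRationalTwoTorsionX W ht
  have hβint : IsIntegral ℚ β := ((AlgebraicClosure.isAlgebraic ℚ).isAlgebraic β).isIntegral
  haveI : FiniteDimensional ℚ ↥(IntermediateField.adjoin ℚ ({β} : Set (AlgebraicClosure ℚ))) := IntermediateField.adjoin.finiteDimensional hβint
  haveI : NumberField ↥(IntermediateField.adjoin ℚ ({β} : Set (AlgebraicClosure ℚ))) := NumberField.mk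
  haveI : Fact (Nat.Prime 2) := ⟨Nat.prime_two⟩
  have h3 : Module.finrank ℚ ↥(IntermediateField.adjoin ℚ ({β} : Set (AlgebraicClosure ℚ))) = 3 :=
    AddKatoTwo.finrank_adjoin_root_twoTorsionPolynomial_eq_three W hirr hβ
  have hodd3 : ¬ 2 ∣ Module.finrank ℚ ↥(IntermediateField.adjoin ℚ ({β} : Set (AlgebraicClosure ℚ))) := by rw [h3]; decide
  have hoddK : Odd (Module.finrank ℚ ↥(IntermediateField.adjoin ℚ ({β} : Set (AlgebraicClosure ℚ)))) :=
    Nat.odd_iff.mpr (Nat.two_dvd_ne_zero.mp hodd3)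
  have hrank : Units.rank ↥(IntermediateField.adjoin ℚ ({β} : Set (AlgebraicClosure ℚ))) = 1 :=
    units_rank_eq_one_of_nrRealPlaces_eq_one _ h3 (nrRealPlaces_adjoin_root_twoTorsionPolynomial_eq_one W hΔ hirr hβ)
  have h8 : minimalDiscriminantInt W % 8 ≠ 1 := by rw [h85]; decide
  have hs := (not_onKilfordStratumAtTwo_iff_minimalDiscriminantInt_emod_eight_ne W hord).mpr h8
  have h2 := ncard_eq_two_of_not_onKilfordStratumAtTwo ↥(IntermediateField.adjoin ℚ ({β} : Set (AlgebraicClosure ℚ))) W hord ht h3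
    (AlignedTransportAtTwoCubicKilfordPrimes.aeval_four_mul_gen_twoDivisionUCubic W hβ) hs
  obtain ⟨h𝔭₁, hP0, h2P, hcard⟩ := isPrime_and_mem_of_absNorm_eq_two 𝔭₁ hN
  haveI := h𝔭₁
  haveI : 𝔭₁.IsMaximal := h𝔭₁.isMaximal hP0
  have hres := forall_mem_or_sub_one_mem_of_card_quotient_eq_two 𝔭₁ hcard
  have h2P' : (2 : 𝓞 ↥(IntermediateField.adjoin ℚ ({β} : Set (AlgebraicClosure ℚ)))) ∉ 𝔭₁ ^ 2 := two_not_mem_sq_of_not_dvd_discr hd 𝔭₁ h2P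
  have hunits := forall_units_sub_one_mem_or_add_one_mem_of_rank_eq_one hoddK hrank 𝔭₁ hP0 hres h2P h2P' hε hnsq
  exact classicalMuVanishes_two_of_generalRelationCert_layer_three hodd3 hd κP hκP h2 hh 𝔭₁ hres h2P hunits q₀ hq₀ hπ t hq ψ hψ hti hPt α β' hBez
    α₁ v₁ hC₁ α₂ v₂ hC₂ α₃ v₃ hC₃ α₄ v₄ hC₄ α₅ v₅ hC₅ α₆ v₆ hC₆ α₇ v₇ hC₇ e₀ e₁ e₂ e₃ e₄ e₅ e₆ e₇ hn hd2 hu hF y₀ y₁ y₂ y₃ y₄ y₅ y₆ y₇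
    hmem₀ hmem₁ hmem₂ hmem₃ hmem₄ hmem₅ hmem₆ hmem₇ U₀ U₁ U₂ U₃ V₀ V₁ hU₀ hU₁ hU₂ hU₃ hV₀ hV₁ εy hNy

end Summit.BirchSwinnertonDyer.BirchSwinnertonDyer.Theorems.AlignedTransportAtTwoCubicLayerThreeGeneralRelationDoor

end
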